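import Summits.Ventures.PercRepro.S1CoreCapSixCost

/-!
# PercRepro — TOWARDS `Q*(6) = 16`: THREE 4-POINT LINES (p1, gen 25)

The extremal case of the instance `ν = 6`. Three lines of `≥ 4` points cost `2 + 2 + 2 + fat` in any order, so at
nullity `6` they are simple 4-point lines with a simple union `U` (`three_big_shape`), and every other line of the
configuration is covered by `U` (`subset_of_three_big`): a simple 3-point TRANSVERSAL meeting each `Lᵢ` in exactly
one point (`transversal_of_three_big`). Placing a transversal first, the last of the three lines must meet the
other two and the transversal in three distinct points (cost `1 + 2 + 2 + 1`), so the transversal's point on `L₁`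
lies off `L₂ ∪ L₃` and `|L₁ ∖ (L₂ ∪ L₃)| ≤ 2` (`meet_of_transversal`). Hence the transversals inject into
`(L₁ ∖ (L₂ ∪ L₃)) × (L₂ ∖ (L₁ ∪ L₃))` by their points on `L₁` and `L₂` (`card_transversals_le_four`) and the cap
sum is `4 + 4 + 4 + #transversals ≤ 16` (`sum_cap_le_sixteen_of_three_big`) — attained by three 4-point lines
forming a triangle with the four transversals avoiding its vertices. `proofs/P1-S4-CAPBRIDGE.md` §17.
Axioms: standard.
-/

namespace PercRepro

namespace S1

namespace FourCap

variable {β : Type} [DecidableEq β]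

omit [DecidableEq β] in
/-- Every line of a configuration has at least two points (for `costSum_le`). -/
theorem two_le_card_of_spec {w : β → ℕ} {ls : Finset (Finset β)}
    (h2 : ∀ L ∈ ls, 3 ≤ L.card ∧ wsum w L ≤ 5) : ∀ L ∈ ls, 2 ≤ L.card :=
  fun L hL => le_trans (by omega) (h2 L hL).1

section ThreeBig

variable {w : β → ℕ} {ls : Finset (Finset β)}
  (h1 : ∀ L ∈ ls, ∀ v ∈ L, w v = 1 ∨ w v = 2)
  (h2 : ∀ L ∈ ls, 3 ≤ L.card ∧ wsum w L ≤ 5)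
  (h3 : ∀ L ∈ ls, ∀ L' ∈ ls, L ≠ L' → (L ∩ L').card ≤ 1)
  (h4 : ∀ l : List (Finset β), l.Nodup → (∀ L ∈ l, L ∈ ls) → wsum w (unionL l) ≤ 6 + lineRank l)
  {L₁ L₂ L₃ : Finset β} (hL₁ : L₁ ∈ ls) (hL₂ : L₂ ∈ ls) (hL₃ : L₃ ∈ ls)
  (h12 : L₂ ≠ L₁) (h13 : L₃ ≠ L₁) (h23 : L₃ ≠ L₂)
  (c1 : 4 ≤ L₁.card) (c2 : 4 ≤ L₂.card) (c3 : 4 ≤ L₃.card)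

include h1 h2 h3 h4 hL₁ hL₂ hL₃ h12 h13 h23 c1 c2 c3 in
/-- **Three big lines are simple 4-point lines with a simple union**: the ordering `L₁, L₂, L₃` costs
`(|L₁| − 2) + (|L₂| − 2) + (|L₃| − 2)` plus the fat points of the union, at most `6`. -/
theorem three_big_shape : L₁.card = 4 ∧ L₂.card = 4 ∧ L₃.card = 4 ∧ fat w L₁ = 0 ∧ fat w (L₂ \ L₁) = 0 ∧
    fat w (L₃ \ (L₂ ∪ L₁)) = 0 := by
  have hc := costSum_le h1 (two_le_card_of_spec h2) h4 [L₃, L₂, L₁] (by simp [h12, h13, h23])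
    (by simp [hL₁, hL₂, hL₃])
  simp only [costSum, unionL, Finset.union_empty, Nat.zero_add] at hc
  rw [lineCost_empty, lineCost_of_inter_le_two (le_trans (h3 L₂ hL₂ L₁ hL₁ h12) (by omega)),
    lineCost_of_inter_le_two (le_trans (card_inter_union_le L₃ L₂ L₁)
      (by have := h3 L₃ hL₃ L₂ hL₂ h23; have := h3 L₃ hL₃ L₁ hL₁ h13; omega))] at hc
  omega

include h1 h2 h3 h4 hL₁ hL₂ hL₃ h12 h13 h23 c1 c2 c3 in
/-- Every point of the union of three big lines is simple. -/
theorem weight_one_of_three_big {v : β} (hv : v ∈ L₃ ∪ (L₂ ∪ L₁)) : w v = 1 := by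
  obtain ⟨-, -, -, f1, f2, f3⟩ := three_big_shape h1 h2 h3 h4 hL₁ hL₂ hL₃ h12 h13 h23 c1 c2 c3
  by_cases hv1 : v ∈ L₁
  · exact weight_one_of_fat_zero (h1 L₁ hL₁) f1 hv1
  by_cases hv2 : v ∈ L₂
  · exact weight_one_of_fat_zero (fun u hu => h1 L₂ hL₂ u (Finset.mem_sdiff.1 hu).1) f2
      (Finset.mem_sdiff.2 ⟨hv2, hv1⟩)
  have hv3 : v ∈ L₃ := by
    rcases Finset.mem_union.1 hv with h | h
    · exact h
    · rcases Finset.mem_union.1 h with h | h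
      · exact absurd h hv2
      · exact absurd h hv1
  exact weight_one_of_fat_zero (fun u hu => h1 L₃ hL₃ u (Finset.mem_sdiff.1 hu).1) f3
    (Finset.mem_sdiff.2 ⟨hv3, fun h => by
      rcases Finset.mem_union.1 h with h | h
      · exact hv2 h
      · exact hv1 h⟩)

include h1 h2 h3 h4 hL₁ hL₂ hL₃ h12 h13 h23 c1 c2 c3 in
/-- **Every other line is covered** by the union of the three big lines: the cost `6` is spent. -/
theorem subset_of_three_big {X : Finset β} (hX : X ∈ ls) (hX1 : X ≠ L₁) (hX2 : X ≠ L₂) (hX3 : X ≠ L₃) :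
    X ⊆ L₃ ∪ (L₂ ∪ L₁) := by
  obtain ⟨e1, e2, e3, f1, f2, f3⟩ := three_big_shape h1 h2 h3 h4 hL₁ hL₂ hL₃ h12 h13 h23 c1 c2 c3
  have hc := costSum_le h1 (two_le_card_of_spec h2) h4 [X, L₃, L₂, L₁] (by simp [h12, h13, h23, hX1, hX2, hX3])
    (by simp [hL₁, hL₂, hL₃, hX])
  simp only [costSum, unionL, Finset.union_empty, Nat.zero_add] at hc
  rw [lineCost_empty, lineCost_of_inter_le_two (le_trans (h3 L₂ hL₂ L₁ hL₁ h12) (by omega)),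
    lineCost_of_inter_le_two (le_trans (card_inter_union_le L₃ L₂ L₁)
      (by have := h3 L₃ hL₃ L₂ hL₂ h23; have := h3 L₃ hL₃ L₁ hL₁ h13; omega))] at hc
  by_contra hsub
  have := one_le_lineCost (w := w) hsub (h2 X hX).1
  omega

include h1 h2 h3 h4 hL₁ hL₂ hL₃ h12 h13 h23 c1 c2 c3 in
/-- **Every other line is a simple transversal**: three points, one on each big line. -/
theorem transversal_of_three_big {X : Finset β} (hX : X ∈ ls) (hX1 : X ≠ L₁) (hX2 : X ≠ L₂) (hX3 : X ≠ L₃) :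
    X.card = 3 ∧ (X ∩ L₁).card = 1 ∧ (X ∩ L₂).card = 1 ∧ (X ∩ L₃).card = 1 ∧ fat w X = 0 := by
  have hsub := subset_of_three_big h1 h2 h3 h4 hL₁ hL₂ hL₃ h12 h13 h23 c1 c2 c3 hX hX1 hX2 hX3
  have hXU : X ∩ (L₃ ∪ (L₂ ∪ L₁)) = X := Finset.inter_eq_left.2 hsub
  have hle : (X ∩ (L₃ ∪ (L₂ ∪ L₁))).card ≤ (X ∩ L₃).card + ((X ∩ L₂).card + (X ∩ L₁).card) :=
    le_trans (card_inter_union_le X L₃ (L₂ ∪ L₁)) (Nat.add_le_add_left (card_inter_union_le X L₂ L₁) _)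
  rw [hXU] at hle
  have i1 := h3 X hX L₁ hL₁ hX1
  have i2 := h3 X hX L₂ hL₂ hX2
  have i3 := h3 X hX L₃ hL₃ hX3
  have hk := (h2 X hX).1
  have hfat : fat w X = 0 := by
    unfold fat
    rw [Finset.card_eq_zero, Finset.filter_eq_empty_iff]
    intro v hv
    have := weight_one_of_three_big h1 h2 h3 h4 hL₁ hL₂ hL₃ h12 h13 h23 c1 c2 c3 (hsub hv)
    omega
  exact ⟨by omega, by omega, by omega, by omega, hfat⟩

include h1 h2 h3 h4 hL₁ hL₂ hL₃ h12 h13 h23 c1 c2 c3 in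
/-- **A transversal placed first**: the last big line meets the other two and the transversal in three distinct
points (the ordering `X, L₁, L₂, L₃` costs `1 + 2 + 2 + (4 − old₃)`), so `|L₃ ∩ (L₂ ∪ (L₁ ∪ X))| = 3`. -/
theorem inter_eq_three_of_transversal {X : Finset β} (hX : X ∈ ls) (hX1 : X ≠ L₁) (hX2 : X ≠ L₂)
    (hX3 : X ≠ L₃) : (L₃ ∩ (L₂ ∪ (L₁ ∪ X))).card = 3 := by
  obtain ⟨e1, e2, e3, -, -, -⟩ := three_big_shape h1 h2 h3 h4 hL₁ hL₂ hL₃ h12 h13 h23 c1 c2 c3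
  obtain ⟨k3, i1, i2, i3, fX⟩ := transversal_of_three_big h1 h2 h3 h4 hL₁ hL₂ hL₃ h12 h13 h23 c1 c2 c3 hX hX1 hX2 hX3
  have hsimple : ∀ v ∈ L₃ ∪ (L₂ ∪ L₁), w v = 1 :=
    fun v hv => weight_one_of_three_big h1 h2 h3 h4 hL₁ hL₂ hL₃ h12 h13 h23 c1 c2 c3 hv
  have hfat : ∀ S : Finset β, S ⊆ L₃ ∪ (L₂ ∪ L₁) → fat w S = 0 := by
    intro S hS
    unfold fat
    rw [Finset.card_eq_zero, Finset.filter_eq_empty_iff]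
    intro v hv
    have := hsimple v (hS hv)
    omega
  have hc := costSum_le h1 (two_le_card_of_spec h2) h4 [L₃, L₂, L₁, X]
    (by simp [h12, h13, h23, hX1.symm, hX2.symm, hX3.symm])
    (by simp [hL₁, hL₂, hL₃, hX])
  simp only [costSum, unionL, Finset.union_empty, Nat.zero_add] at hc
  have hX1' : (L₁ ∩ X).card ≤ 2 := le_trans (h3 L₁ hL₁ X hX hX1.symm) (by omega)
  have hX2' : (L₂ ∩ (L₁ ∪ X)).card ≤ 2 := le_trans (card_inter_union_le L₂ L₁ X)
    (by have := h3 L₂ hL₂ L₁ hL₁ h12; have := h3 L₂ hL₂ X hX hX2.symm; omega)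
  have hX3' : (L₃ ∩ (L₂ ∪ (L₁ ∪ X))).card ≤ 3 := le_trans (card_inter_union_le L₃ L₂ (L₁ ∪ X))
    (le_trans (Nat.add_le_add_left (card_inter_union_le L₃ L₁ X) _)
      (by have := h3 L₃ hL₃ L₂ hL₂ h23; have := h3 L₃ hL₃ L₁ hL₁ h13; have := h3 L₃ hL₃ X hX hX3.symm; omega))
  rw [lineCost_empty, lineCost_of_inter_le_two hX1', lineCost_of_inter_le_two hX2', fX,
    hfat (L₁ \ X) (fun v hv => by simp [Finset.mem_sdiff.1 hv |>.1]),
    hfat (L₂ \ (L₁ ∪ X)) (fun v hv => by simp [Finset.mem_sdiff.1 hv |>.1])] at hc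
  have hlast := lineCost_ge (w := w) L₃ (L₂ ∪ (L₁ ∪ X))
  omega

include h1 h2 h3 h4 hL₁ hL₂ hL₃ h12 h13 h23 c1 c2 c3 in
/-- **The transversal's point on the last line is off the other two, which meet it in two points**:
`X ∩ L₃ ⊆ L₃ ∖ (L₂ ∪ L₁)` and `|L₃ ∖ (L₂ ∪ L₁)| ≤ 2`. -/
theorem meet_of_transversal {X : Finset β} (hX : X ∈ ls) (hX1 : X ≠ L₁) (hX2 : X ≠ L₂) (hX3 : X ≠ L₃) :
    X ∩ L₃ ⊆ L₃ \ (L₂ ∪ L₁) ∧ (L₃ \ (L₂ ∪ L₁)).card ≤ 2 := by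
  obtain ⟨e1, e2, e3, -, -, -⟩ := three_big_shape h1 h2 h3 h4 hL₁ hL₂ hL₃ h12 h13 h23 c1 c2 c3
  have h3' := inter_eq_three_of_transversal h1 h2 h3 h4 hL₁ hL₂ hL₃ h12 h13 h23 c1 c2 c3 hX hX1 hX2 hX3
  have hsplit : L₃ ∩ (L₂ ∪ (L₁ ∪ X)) ⊆ (L₃ ∩ (L₂ ∪ L₁)) ∪ (X ∩ L₃) := by
    intro v hv
    obtain ⟨hv3, hv'⟩ := Finset.mem_inter.1 hv
    rcases Finset.mem_union.1 hv' with h | h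
    · exact Finset.mem_union_left _ (Finset.mem_inter.2 ⟨hv3, Finset.mem_union_left _ h⟩)
    · rcases Finset.mem_union.1 h with h | h
      · exact Finset.mem_union_left _ (Finset.mem_inter.2 ⟨hv3, Finset.mem_union_right _ h⟩)
      · exact Finset.mem_union_right _ (Finset.mem_inter.2 ⟨h, hv3⟩)
  have hle := Finset.card_le_card hsplit
  have hu := Finset.card_union_le (L₃ ∩ (L₂ ∪ L₁)) (X ∩ L₃)
  have hi2 : (L₃ ∩ (L₂ ∪ L₁)).card ≤ 2 := le_trans (card_inter_union_le L₃ L₂ L₁)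
    (by have := h3 L₃ hL₃ L₂ hL₂ h23; have := h3 L₃ hL₃ L₁ hL₁ h13; omega)
  have hiX : (X ∩ L₃).card ≤ 1 := h3 X hX L₃ hL₃ hX3
  have hsd := Finset.card_sdiff_add_card_inter L₃ (L₂ ∪ L₁)
  refine ⟨?_, by omega⟩
  intro v hv
  obtain ⟨hvX, hv3⟩ := Finset.mem_inter.1 hv
  refine Finset.mem_sdiff.2 ⟨hv3, fun hv' => ?_⟩
  -- if the point of `X` on `L₃` lay on `L₂ ∪ L₁`, the three-point intersection would sit inside `L₃ ∩ (L₂ ∪ L₁)`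
  have hsub : L₃ ∩ (L₂ ∪ (L₁ ∪ X)) ⊆ L₃ ∩ (L₂ ∪ L₁) := by
    intro u hu
    obtain ⟨hu3, hu'⟩ := Finset.mem_inter.1 hu
    refine Finset.mem_inter.2 ⟨hu3, ?_⟩
    rcases Finset.mem_union.1 hu' with h | h
    · exact Finset.mem_union_left _ h
    · rcases Finset.mem_union.1 h with h | h
      · exact Finset.mem_union_right _ h
      · -- `u ∈ X ∩ L₃ = {v}`
        have huv : u = v := Finset.card_le_one.1 hiX u (Finset.mem_inter.2 ⟨h, hu3⟩) v hv
        exact huv ▸ hv'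
  have := Finset.card_le_card hsub
  omega

include h1 h2 h3 h4 hL₁ hL₂ hL₃ h12 h13 h23 c1 c2 c3 in
/-- **At most four transversals**: they inject into `(L₁ ∖ (L₂ ∪ L₃)) × (L₂ ∖ (L₁ ∪ L₃))`, two sets of at most
two points, by their points on `L₁` and on `L₂`. -/
theorem card_transversals_le_four : (((ls.erase L₁).erase L₂).erase L₃).card ≤ 4 := by
  set T := ((ls.erase L₁).erase L₂).erase L₃ with hT
  have hTmem : ∀ X ∈ T, X ∈ ls ∧ X ≠ L₁ ∧ X ≠ L₂ ∧ X ≠ L₃ := by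
    intro X hX
    rw [hT, Finset.mem_erase, Finset.mem_erase, Finset.mem_erase] at hX
    exact ⟨hX.2.2.2, hX.2.2.1, hX.2.1, hX.1⟩
  rcases Finset.eq_empty_or_nonempty T with hempty | ⟨X₀, hX₀⟩
  · rw [hempty]; simp
  obtain ⟨hX₀ls, hX₀1, hX₀2, hX₀3⟩ := hTmem X₀ hX₀
  -- the two target sets, via the symmetric instances of `meet_of_transversal` (`L₁` last, `L₂` last)
  have m1 := fun X (hX : X ∈ ls) (hX1 : X ≠ L₁) (hX2 : X ≠ L₂) (hX3 : X ≠ L₃) =>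
    meet_of_transversal h1 h2 h3 h4 hL₂ hL₃ hL₁ h23 h12.symm h13.symm c2 c3 c1 hX hX2 hX3 hX1
  have m2 := fun X (hX : X ∈ ls) (hX1 : X ≠ L₁) (hX2 : X ≠ L₂) (hX3 : X ≠ L₃) =>
    meet_of_transversal h1 h2 h3 h4 hL₁ hL₃ hL₂ h13 h12 h23.symm c1 c3 c2 hX hX1 hX3 hX2
  set A := L₁ \ (L₃ ∪ L₂) with hA
  set B := L₂ \ (L₃ ∪ L₁) with hB
  have hAc : A.card ≤ 2 := (m1 X₀ hX₀ls hX₀1 hX₀2 hX₀3).2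
  have hBc : B.card ≤ 2 := (m2 X₀ hX₀ls hX₀1 hX₀2 hX₀3).2
  have hinj : T.card ≤ (A.powersetCard 1 ×ˢ B.powersetCard 1).card := by
    refine Finset.card_le_card_of_injOn (fun X => (X ∩ L₁, X ∩ L₂)) ?_ ?_
    · intro X hX
      obtain ⟨hXls, hX1, hX2, hX3⟩ := hTmem X hX
      obtain ⟨k3, i1, i2, i3, -⟩ :=
        transversal_of_three_big h1 h2 h3 h4 hL₁ hL₂ hL₃ h12 h13 h23 c1 c2 c3 hXls hX1 hX2 hX3
      refine Finset.mem_product.2 ⟨Finset.mem_powersetCard.2 ⟨(m1 X hXls hX1 hX2 hX3).1, i1⟩,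
        Finset.mem_powersetCard.2 ⟨(m2 X hXls hX1 hX2 hX3).1, i2⟩⟩
    · intro X hX X' hX' hXX'
      simp only [Prod.mk.injEq] at hXX'
      obtain ⟨hXls, hX1, hX2, hX3⟩ := hTmem X (Finset.mem_coe.1 hX)
      obtain ⟨hX'ls, -, -, -⟩ := hTmem X' (Finset.mem_coe.1 hX')
      obtain ⟨-, i1, i2, -, -⟩ :=
        transversal_of_three_big h1 h2 h3 h4 hL₁ hL₂ hL₃ h12 h13 h23 c1 c2 c3 hXls hX1 hX2 hX3
      by_contra hne
      have hle := h3 X hXls X' hX'ls hne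
      -- `X ∩ L₁ ∪ X ∩ L₂ ⊆ X ∩ X'`, two disjoint singletons
      have hsub : (X ∩ L₁) ∪ (X ∩ L₂) ⊆ X ∩ X' := by
        intro v hv
        rcases Finset.mem_union.1 hv with h | h
        · have h' : v ∈ X' ∩ L₁ := hXX'.1 ▸ h
          exact Finset.mem_inter.2 ⟨(Finset.mem_inter.1 h).1, (Finset.mem_inter.1 h').1⟩
        · have h' : v ∈ X' ∩ L₂ := hXX'.2 ▸ h
          exact Finset.mem_inter.2 ⟨(Finset.mem_inter.1 h).1, (Finset.mem_inter.1 h').1⟩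
      have hdisj : Disjoint (X ∩ L₁) (X ∩ L₂) := by
        rw [Finset.disjoint_left]
        intro v hv hv'
        have hvA := (m1 X hXls hX1 hX2 hX3).1 hv
        exact (Finset.mem_sdiff.1 hvA).2 (Finset.mem_union_right _ (Finset.mem_inter.1 hv').2)
      have := Finset.card_le_card hsub
      rw [Finset.card_union_of_disjoint hdisj] at this
      omega
  rw [Finset.card_product, Finset.card_powersetCard, Finset.card_powersetCard, Nat.choose_one_right,
    Nat.choose_one_right] at hinj
  calc T.card ≤ A.card * B.card := hinj
    _ ≤ 2 * 2 := Nat.mul_le_mul hAc hBc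
    _ = 4 := by omega

include h1 h2 h3 h4 hL₁ hL₂ hL₃ h12 h13 h23 c1 c2 c3 in
/-- **Three big lines: cap sum `≤ 16`** — `4 + 4 + 4` plus at most four simple transversals. -/
theorem sum_cap_le_sixteen_of_three_big : ∑ L ∈ ls, capPaper L.card (fat w L) ≤ 16 := by
  obtain ⟨e1, e2, e3, f1, f2, f3⟩ := three_big_shape h1 h2 h3 h4 hL₁ hL₂ hL₃ h12 h13 h23 c1 c2 c3
  have hfat2 : fat w L₂ = 0 := by
    have := fat_sdiff_add_fat_inter w L₂ L₁
    have h0 : fat w (L₂ ∩ L₁) = 0 := by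
      unfold fat
      rw [Finset.card_eq_zero, Finset.filter_eq_empty_iff]
      intro v hv
      have := weight_one_of_fat_zero (h1 L₁ hL₁) f1 (Finset.mem_inter.1 hv).2
      omega
    omega
  have hfat3 : fat w L₃ = 0 := by
    have := fat_sdiff_add_fat_inter w L₃ (L₂ ∪ L₁)
    have h0 : fat w (L₃ ∩ (L₂ ∪ L₁)) = 0 := by
      unfold fat
      rw [Finset.card_eq_zero, Finset.filter_eq_empty_iff]
      intro v hv
      have := weight_one_of_three_big h1 h2 h3 h4 hL₁ hL₂ hL₃ h12 h13 h23 c1 c2 c3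
        (Finset.mem_union_right _ (Finset.mem_inter.1 hv).2)
      omega
    omega
  have hL₂' : L₂ ∈ ls.erase L₁ := Finset.mem_erase.2 ⟨h12, hL₂⟩
  have hL₃' : L₃ ∈ (ls.erase L₁).erase L₂ := Finset.mem_erase.2 ⟨h23, Finset.mem_erase.2 ⟨h13, hL₃⟩⟩
  rw [← Finset.add_sum_erase ls _ hL₁, ← Finset.add_sum_erase _ _ hL₂', ← Finset.add_sum_erase _ _ hL₃']
  have hcap : ∀ X ∈ ((ls.erase L₁).erase L₂).erase L₃, capPaper X.card (fat w X) = 1 := by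
    intro X hX
    rw [Finset.mem_erase, Finset.mem_erase, Finset.mem_erase] at hX
    obtain ⟨k3, -, -, -, fX⟩ := transversal_of_three_big h1 h2 h3 h4 hL₁ hL₂ hL₃ h12 h13 h23 c1 c2 c3
      hX.2.2.2 hX.2.2.1 hX.2.1 hX.1
    rw [k3, fX]; decide
  rw [Finset.sum_congr rfl hcap, ← Finset.card_eq_sum_ones, e1, e2, e3, f1, hfat2, hfat3]
  have := card_transversals_le_four h1 h2 h3 h4 hL₁ hL₂ hL₃ h12 h13 h23 c1 c2 c3
  simp only [capPaper]
  omega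

end ThreeBig

end FourCap

end S1

end PercRepro
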